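import Summits.QuantumFields.BalabanUV.Beta.GAN24.WSlotSourceZeroModeZfree
import Summits.QuantumFields.BalabanUV.Beta.GAN24.ResponseExchangeStep
import Summits.QuantumFields.BalabanUV.Beta.GAN24.WSlotOfShapes
import Summits.QuantumFields.BalabanUV.Beta.MixedJetTablesPlug

/-!
# `BalabanUV.Beta.GAN24.WSlotSourceZeroModeHolds` — binder row G-an2-4 ∕ (CONV-C), W-slot road «W3» (gan24-p1 `SKELETON-W3.md` v1.0.2 §8.3),
# **ROW W3-F2a `hZ : ∀ m, Zfree (b m)` — THE PLUG**: the four (S3c)-channel bond sums of leaf-06-g9's «W3-S3C*» PART 6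
# (`ResponseExchangeStep.hasSum_tsum_prod_{exchange,exchange_swap,resp,resp_swap}_step`) and the per-level shape data (an2 `locStencil_Spure`,
# leaf-07 `WSlotOfShapes`) discharge every hypothesis of the assembly (`WSlotSourceZeroModeZfree.zfree_bracket_of_channels`, Part C) BY NAME

NOT IN PRINT; OUR BOOKKEEPING (G-an2-4 formalisation swarm, leaf prover `b2b-balaban-gan24-formalise-leaf-20`, gen 18; journal INTENT «W3-ZS*» l.9181;
name PROVISIONAL).  HONEST FRAMING (cell contract, verbatim): «discharging `BetaPertH` makes Bałaban's UV stability UNCONDITIONAL — a real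
constructive-QFT result; it is NOT the continuum limit and NOT the Clay problem.»  HONEST DEPENDENCY (verbatim): «continuum YM on T⁴ ⇐ BetaPertH ∧
nine spine estimates (0/9 proved); BetaPertH ⇐ (D1) ∧ (D4) ∧ CAP+tail; G-an2-4 gates asym, D1 and NE2/3/4.»

WHAT (every `j`, generic `d`, `1 ≤ Lc`, ALL colour constants `cE cVH cΛ cE₂ cB` symbolic, NO pin, NO sign convention used):
* §10 **`zfree_bracket`** — ROW W3-F2a AT MEMBER `j` IN THE `Zfree` OF RECORD (ref2 r57: «(jointly Lc-covariant) ∧ (∀ κ κ′ κ₁ κ₂,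
  zmode Lc X κ κ′ (inl κ₁) (inl κ₂) = 0)») for leaf-04's LITERAL source
  `b_j = (cE₂·Lc^{2(d+1)}) • mmRead Lc (K3OfK K♮_j Lc S♮_j M♮_j (W2SymOfK K♮_j Lc S♮_j M♮_j 0 M₂♮_j) · ·) + cB • mfNeg (vh₂S · ·)` at a GENERIC
  border `vh₂S` (binders: block covariance `hBt`, vanishing ff block `hBff`) and a GENERIC mixed binder table `mixFF` (binders: `hmixt`,
  `LocStencilFM` shape `hmix`, supports `hfm`∕`hm` — the END's own binders); **`inner_bracket`** — the pointwise transversal form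
  `Σ'_{u′} Σ'_x Σ'_z b_j κ u κ′ u′ x z (inl α) (inl β) = 0` (leaf-18's `WSlotForcingZeroMode.hZf_of_hZ_pointwise` input).
* §11 **`zfree_bracket_an1`** — the same at an1's tables, ANY box roots (`vh₂S := vh₂SAt ρ Lc`, `mixFF := mixFFAt (toSite r) Lc`, `r ∈ box`):
  NO binder left but `1 ≤ Lc` and the root; the partial application `zfree_bracket_an1 hLc hr ρ cE cVH cΛ cE₂ cB : ∀ m, …` IS the row text
  `hZ : ∀ m, Zfree (b m)` of `WSlotT2OfPieces.t2Shape_of_rows` at the r57 instantiation.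
* §12 **`zfree_bracket_base`**, **`hZ_cell_base`** — the same at the BASE-root border `vh₂S d Lc` (the END's literal text; `hZ_cell_base` is the `hZ`
  hypothesis of leaf-12's `T2ShapeThreeOfF2a.t2Shape_three_an1_of_F2a` ∕ `hW_three_an1_of_F2a`, token for token at `d = 3`).
HONEST: [folklore] composition BY NAME — the mechanism is leaf-06-g9's (channels) + leaf-14-g23's (mixed channel, W-reduction, transposition)
+ leaf-11-g18's (covariance) + leaf-16's (`zmode` bridge) + an2∕an5∕leaf-07 (shapes); asserts NO value of Bałaban's tables beyond the tree's
DEFINED objects; NOT «T2Shape», NOT (hW, hWall), 0∕2 wall binders; NOT «W-slot closed» (nor under an undischarged pin), NEVER «G-an2-4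
closed»; NOT BetaPertH, NOT continuum, NOT Clay.  0 def, 0 cite, 0 `def … : Prop`, 0 sorry.
-/

noncomputable section

open Literature.MathematicalPhysics.QuantumFieldTheory
open Literature.MathematicalPhysics.QuantumFieldTheory.Balaban1983to89
open Literature.MathematicalPhysics.QuantumFieldTheory.Balaban1983to89.Beta
open AffineAveraging (Site box toSite)
open ExpKernelCalculus (MKer shiftK)
open OneStepResolventKernel (Fib)
open OneStepKernelFamily (KInvStep)
open StepJetData (mfNeg)
open SecondOrderResponse (W2SymOfK LocStencilFM)
open BalabanStepW2 (K3OfK Spure M1 M2Of locStencil_Spure)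
open BalabanStepJetsSucc (mmRead)
open AveragingMixedJetTables (vh₂S vh₂SAt mixFFAt mixFFAt_inl_inr mixFFAt_inr)
open Summit.QuantumFields.BalabanUV.Beta.HessKerDressedUnits (unitK unitS locStencil_unitS)
open Summit.QuantumFields.BalabanUV.Beta.SecondOrderUnits (unitM unitM₂)
open Summit.QuantumFields.BalabanUV.Beta.MixedJetTablesPlug (hmix_an1 hmixt_an1 hBt_an1)
open Summit.QuantumFields.BalabanUV.Beta.GAN24.CombesThomas (sfStep smStep)
open Summit.QuantumFields.BalabanUV.Beta.GAN24.BiStencilZeroMode (Tab zmode)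
open Summit.QuantumFields.BalabanUV.Beta.GAN24.T2OfDiffCovariance (vh₂SAt_inl_inl')
open Summit.QuantumFields.BalabanUV.Beta.GAN24.WSlotOfShapes (vertexFamily_unitM_M1 locStencilFM_unitM₂_M2Of)
open Summit.QuantumFields.BalabanUV.Beta.GAN24.ResponseExchangeStep (hasSum_tsum_prod_resp_step hasSum_tsum_prod_resp_swap_step
  hasSum_tsum_prod_exchange_step hasSum_tsum_prod_exchange_swap_step)
open Summit.QuantumFields.BalabanUV.Beta.GAN24.WSlotSourceZeroModeStep (inner_bracket_eq_zero)
open Summit.QuantumFields.BalabanUV.Beta.GAN24.WSlotSourceZeroModeZfree (unitM₂_translate zfree_bracket_of_channels)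

namespace Summit.QuantumFields.BalabanUV.Beta.GAN24.WSlotSourceZeroModeHolds

variable {d : ℕ} {Lc : ℕ} [NeZero Lc]

/-! ## §10 ROW W3-F2a at member `j`, generic border and mixed binder table -/

section Generic

variable (hLc : 1 ≤ Lc) (cE cVH cΛ cE₂ cB : ℝ) {mixFF : Tab d}
  (hmixt : ∀ (κ : Fin (d + 1)) (u : Fin (d + 1) → ℤ) (ρ : Fin (d + 1)) (w t : Fin (d + 1) → ℤ),
    mixFF κ (u + (Lc : ℤ) • t) ρ (w + t) = shiftK (-((Lc : ℤ) • t)) (mixFF κ u ρ w))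
  {CM₂ δ₄ : ℝ} (hmix : LocStencilFM Lc mixFF CM₂ δ₄) (hδ₄ : 0 < δ₄)
  (hfm : ∀ κ u ρ w x z (α μ' : Fin (d + 1)), mixFF κ u ρ w x z (Sum.inl α) (Sum.inr μ') = 0)
  (hm : ∀ κ u ρ w x z (μ' : Fin (d + 1)) (b : Fib d), mixFF κ u ρ w x z (Sum.inr μ') b = 0)
  {vh₂S : Tab d}
  (hBt : ∀ (κ : Fin (d + 1)) (u : Fin (d + 1) → ℤ) (κ' : Fin (d + 1)) (u' t : Fin (d + 1) → ℤ),
    vh₂S κ (u + (Lc : ℤ) • t) κ' (u' + (Lc : ℤ) • t) = shiftK (-((Lc : ℤ) • t)) (vh₂S κ u κ' u'))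
  (hBff : ∀ κ u κ' u' x z (α β : Fin (d + 1)), vh₂S κ u κ' u' x z (Sum.inl α) (Sum.inl β) = 0)
  (j : ℕ)

include hLc hmixt hmix hδ₄ hfm hm hBt hBff in
/-- NOT IN PRINT; OUR BOOKKEEPING.  **ROW W3-F2a AT MEMBER `j` — `Zfree` OF RECORD, EVERY HYPOTHESIS OF THE ASSEMBLY DISCHARGED BY NAME.**
For leaf-04's literal source `b_j` (module docstring) at a generic border `vh₂S` (`hBt`, `hBff`) and mixed binder table `mixFF` (`hmixt`, `hmix`,
`hfm`, `hm`): `(∀ κ u κ′ u′ t, b_j κ (u + Lc•t) κ′ (u′ + Lc•t) = shiftK (−Lc•t) (b_j κ u κ′ u′)) ∧ (∀ κ κ′ κ₁ κ₂, zmode Lc b_j κ κ′ (inl κ₁) (inl κ₂) = 0)`.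
Part C `zfree_bracket_of_channels` with: `S♮_j` shape = an2 `locStencil_Spure` ⨾ `locStencil_unitS`; `M♮_j` = leaf-07 `vertexFamily_unitM_M1`;
`M₂♮_j` = leaf-07 `locStencilFM_unitM₂_M2Of`; the four channel bond sums = leaf-06-g9's `ResponseExchangeStep.hasSum_tsum_prod_*_step` at
units `(sfStep Lc j, smStep d Lc j)`. -/
theorem zfree_bracket :
    (∀ (κ : Fin (d + 1)) (u : Site (d + 1)) (κ' : Fin (d + 1)) (u' t : Site (d + 1)),
      (fun κ u κ' u' => (cE₂ * (Lc : ℝ) ^ (2 * (d + 1))) •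
          mmRead Lc (K3OfK (unitK (sfStep Lc j) (smStep d Lc j) (KInvStep (d := d) Lc j)) Lc
            (unitS (sfStep Lc j) (smStep d Lc j) (Spure d Lc cE cVH cΛ j)) (unitM (sfStep Lc j) (smStep d Lc j) (M1 d Lc cΛ j))
            (W2SymOfK (unitK (sfStep Lc j) (smStep d Lc j) (KInvStep (d := d) Lc j)) Lc
              (unitS (sfStep Lc j) (smStep d Lc j) (Spure d Lc cE cVH cΛ j)) (unitM (sfStep Lc j) (smStep d Lc j) (M1 d Lc cΛ j)) 0
              (unitM₂ (sfStep Lc j) (smStep d Lc j) (M2Of d Lc mixFF j))) κ u κ' u')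
        + cB • mfNeg (vh₂S κ u κ' u')) κ (u + (Lc : ℤ) • t) κ' (u' + (Lc : ℤ) • t)
      = shiftK (-((Lc : ℤ) • t)) ((fun κ u κ' u' => (cE₂ * (Lc : ℝ) ^ (2 * (d + 1))) •
          mmRead Lc (K3OfK (unitK (sfStep Lc j) (smStep d Lc j) (KInvStep (d := d) Lc j)) Lc
            (unitS (sfStep Lc j) (smStep d Lc j) (Spure d Lc cE cVH cΛ j)) (unitM (sfStep Lc j) (smStep d Lc j) (M1 d Lc cΛ j))
            (W2SymOfK (unitK (sfStep Lc j) (smStep d Lc j) (KInvStep (d := d) Lc j)) Lc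
              (unitS (sfStep Lc j) (smStep d Lc j) (Spure d Lc cE cVH cΛ j)) (unitM (sfStep Lc j) (smStep d Lc j) (M1 d Lc cΛ j)) 0
              (unitM₂ (sfStep Lc j) (smStep d Lc j) (M2Of d Lc mixFF j))) κ u κ' u')
        + cB • mfNeg (vh₂S κ u κ' u')) κ u κ' u')) ∧
    (∀ (κ κ' κ₁ κ₂ : Fin (d + 1)),
      zmode Lc (fun κ u κ' u' => (cE₂ * (Lc : ℝ) ^ (2 * (d + 1))) •
          mmRead Lc (K3OfK (unitK (sfStep Lc j) (smStep d Lc j) (KInvStep (d := d) Lc j)) Lc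
            (unitS (sfStep Lc j) (smStep d Lc j) (Spure d Lc cE cVH cΛ j)) (unitM (sfStep Lc j) (smStep d Lc j) (M1 d Lc cΛ j))
            (W2SymOfK (unitK (sfStep Lc j) (smStep d Lc j) (KInvStep (d := d) Lc j)) Lc
              (unitS (sfStep Lc j) (smStep d Lc j) (Spure d Lc cE cVH cΛ j)) (unitM (sfStep Lc j) (smStep d Lc j) (M1 d Lc cΛ j)) 0
              (unitM₂ (sfStep Lc j) (smStep d Lc j) (M2Of d Lc mixFF j))) κ u κ' u')
        + cB • mfNeg (vh₂S κ u κ' u')) κ κ' (Sum.inl κ₁) (Sum.inl κ₂) = 0) := by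
  obtain ⟨Cs, δS, hδS, hS⟩ := locStencil_Spure (d := d) (Lc := Lc) hLc cE cVH cΛ j
  exact zfree_bracket_of_channels hLc cE cVH cΛ cE₂ cB hmixt hBt hBff j (locStencil_unitS hS) hδS
    (vertexFamily_unitM_M1 hLc cΛ zero_le_one j) one_pos (locStencilFM_unitM₂_M2Of hmix hfm hm j) hδ₄
    (fun κ u κ' α β => hasSum_tsum_prod_exchange_step hLc _ _ cE cVH cΛ j κ u κ' α β)
    (fun κ u κ' α β => hasSum_tsum_prod_exchange_swap_step hLc _ _ cE cVH cΛ j κ u κ' α β)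
    (fun κ u κ' α β => hasSum_tsum_prod_resp_step hLc _ _ cE cVH cΛ j κ u κ' α β)
    (fun κ u κ' α β => hasSum_tsum_prod_resp_swap_step hLc _ _ cE cVH cΛ j κ u κ' α β)

include hLc hmixt hmix hδ₄ hfm hm hBff in
/-- NOT IN PRINT; OUR BOOKKEEPING.  **ROW W3-F2a AT MEMBER `j` — POINTWISE TRANSVERSAL FORM** (the `hZ` of leaf-18's
`WSlotForcingZeroMode.hZf_of_hZ_pointwise`): at every first bond, `Σ'_{u′} Σ'_x Σ'_z b_j κ u κ′ u′ x z (inl α) (inl β) = 0` — Part B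
`inner_bracket_eq_zero` with every hypothesis discharged as in `zfree_bracket` (no border covariance needed here). -/
theorem inner_bracket (κ : Fin (d + 1)) (u : Site (d + 1)) (κ' α β : Fin (d + 1)) :
    (∑' u', ∑' x, ∑' z, (fun κ u κ' u' => (cE₂ * (Lc : ℝ) ^ (2 * (d + 1))) •
          mmRead Lc (K3OfK (unitK (sfStep Lc j) (smStep d Lc j) (KInvStep (d := d) Lc j)) Lc
            (unitS (sfStep Lc j) (smStep d Lc j) (Spure d Lc cE cVH cΛ j)) (unitM (sfStep Lc j) (smStep d Lc j) (M1 d Lc cΛ j))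
            (W2SymOfK (unitK (sfStep Lc j) (smStep d Lc j) (KInvStep (d := d) Lc j)) Lc
              (unitS (sfStep Lc j) (smStep d Lc j) (Spure d Lc cE cVH cΛ j)) (unitM (sfStep Lc j) (smStep d Lc j) (M1 d Lc cΛ j)) 0
              (unitM₂ (sfStep Lc j) (smStep d Lc j) (M2Of d Lc mixFF j))) κ u κ' u')
        + cB • mfNeg (vh₂S κ u κ' u')) κ u κ' u' x z (Sum.inl α) (Sum.inl β)) = 0 := by
  obtain ⟨Cs, δS, hδS, hS⟩ := locStencil_Spure (d := d) (Lc := Lc) hLc cE cVH cΛ j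
  exact inner_bracket_eq_zero cE cVH cΛ cE₂ cB mixFF j hBff (locStencil_unitS hS) hδS
    (vertexFamily_unitM_M1 hLc cΛ zero_le_one j) one_pos (locStencilFM_unitM₂_M2Of hmix hfm hm j) hδ₄
    (fun κ u ρ w t => unitM₂_translate (sfStep Lc j) (smStep d Lc j) (fun κ u ρ w t => BalabanStepW2.M2Of_translate hmixt j κ u ρ w t) κ u ρ w t)
    κ u κ' α β
    (hasSum_tsum_prod_exchange_step hLc _ _ cE cVH cΛ j κ u κ' α β)
    (hasSum_tsum_prod_exchange_swap_step hLc _ _ cE cVH cΛ j κ u κ' α β)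
    (hasSum_tsum_prod_resp_step hLc _ _ cE cVH cΛ j κ u κ' α β)
    (hasSum_tsum_prod_resp_swap_step hLc _ _ cE cVH cΛ j κ u κ' α β)

end Generic

/-! ## §11 ROW W3-F2a at an1's tables, any box roots: no binder left but `1 ≤ Lc` and the root -/

/-- NOT IN PRINT; OUR BOOKKEEPING.  **ROW W3-F2a AT MEMBER `j`, an1's TABLES** (`vh₂S := vh₂SAt ρ Lc` at any root `ρ`,
`mixFF := mixFFAt (toSite r) Lc` at a box root `r`): §10 with an1's binders `MixedJetTablesPlug.hmixt_an1`∕`hmix_an1`∕`hBt_an1`, the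
supports `mixFFAt_inl_inr`∕`mixFFAt_inr` and the border's vanishing ff block `T2OfDiffCovariance.vh₂SAt_inl_inl'`. -/
theorem zfree_bracket_an1 (hLc : 1 ≤ Lc) {r : Fin (d + 1) → ℕ} (hr : r ∈ box (d + 1) Lc) (ρ : Fin (d + 1) → ℤ)
    (cE cVH cΛ cE₂ cB : ℝ) (j : ℕ) :
    (∀ (κ : Fin (d + 1)) (u : Site (d + 1)) (κ' : Fin (d + 1)) (u' t : Site (d + 1)),
      (fun κ u κ' u' => (cE₂ * (Lc : ℝ) ^ (2 * (d + 1))) •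
          mmRead Lc (K3OfK (unitK (sfStep Lc j) (smStep d Lc j) (KInvStep (d := d) Lc j)) Lc
            (unitS (sfStep Lc j) (smStep d Lc j) (Spure d Lc cE cVH cΛ j)) (unitM (sfStep Lc j) (smStep d Lc j) (M1 d Lc cΛ j))
            (W2SymOfK (unitK (sfStep Lc j) (smStep d Lc j) (KInvStep (d := d) Lc j)) Lc
              (unitS (sfStep Lc j) (smStep d Lc j) (Spure d Lc cE cVH cΛ j)) (unitM (sfStep Lc j) (smStep d Lc j) (M1 d Lc cΛ j)) 0
              (unitM₂ (sfStep Lc j) (smStep d Lc j) (M2Of d Lc (mixFFAt (toSite r) Lc) j))) κ u κ' u')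
        + cB • mfNeg (vh₂SAt ρ Lc κ u κ' u')) κ (u + (Lc : ℤ) • t) κ' (u' + (Lc : ℤ) • t)
      = shiftK (-((Lc : ℤ) • t)) ((fun κ u κ' u' => (cE₂ * (Lc : ℝ) ^ (2 * (d + 1))) •
          mmRead Lc (K3OfK (unitK (sfStep Lc j) (smStep d Lc j) (KInvStep (d := d) Lc j)) Lc
            (unitS (sfStep Lc j) (smStep d Lc j) (Spure d Lc cE cVH cΛ j)) (unitM (sfStep Lc j) (smStep d Lc j) (M1 d Lc cΛ j))
            (W2SymOfK (unitK (sfStep Lc j) (smStep d Lc j) (KInvStep (d := d) Lc j)) Lc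
              (unitS (sfStep Lc j) (smStep d Lc j) (Spure d Lc cE cVH cΛ j)) (unitM (sfStep Lc j) (smStep d Lc j) (M1 d Lc cΛ j)) 0
              (unitM₂ (sfStep Lc j) (smStep d Lc j) (M2Of d Lc (mixFFAt (toSite r) Lc) j))) κ u κ' u')
        + cB • mfNeg (vh₂SAt ρ Lc κ u κ' u')) κ u κ' u')) ∧
    (∀ (κ κ' κ₁ κ₂ : Fin (d + 1)),
      zmode Lc (fun κ u κ' u' => (cE₂ * (Lc : ℝ) ^ (2 * (d + 1))) •
          mmRead Lc (K3OfK (unitK (sfStep Lc j) (smStep d Lc j) (KInvStep (d := d) Lc j)) Lc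
            (unitS (sfStep Lc j) (smStep d Lc j) (Spure d Lc cE cVH cΛ j)) (unitM (sfStep Lc j) (smStep d Lc j) (M1 d Lc cΛ j))
            (W2SymOfK (unitK (sfStep Lc j) (smStep d Lc j) (KInvStep (d := d) Lc j)) Lc
              (unitS (sfStep Lc j) (smStep d Lc j) (Spure d Lc cE cVH cΛ j)) (unitM (sfStep Lc j) (smStep d Lc j) (M1 d Lc cΛ j)) 0
              (unitM₂ (sfStep Lc j) (smStep d Lc j) (M2Of d Lc (mixFFAt (toSite r) Lc) j))) κ u κ' u')
        + cB • mfNeg (vh₂SAt ρ Lc κ u κ' u')) κ κ' (Sum.inl κ₁) (Sum.inl κ₂) = 0) := by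
  obtain ⟨CM₂, δ₄, hδ₄, hmix⟩ := hmix_an1 (d := d) hLc hr
  exact zfree_bracket hLc cE cVH cΛ cE₂ cB (hmixt_an1 (toSite r)) hmix hδ₄
    (fun κ u ρ' w x z α μ' => mixFFAt_inl_inr (toSite r) Lc κ u ρ' w x z α μ')
    (fun κ u ρ' w x z μ' b => mixFFAt_inr (toSite r) Lc κ u ρ' w x z μ' b)
    (hBt_an1 hLc ρ) (fun κ u κ' u' x z α β => vh₂SAt_inl_inl' ρ Lc κ u κ' u' x z α β) j

/-! ## §12 The row text at the BASE-root border `vh₂S d Lc` (the END's literal instantiation; leaf-12's `T2ShapeThreeOfF2a` input) -/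

/-- NOT IN PRINT; OUR BOOKKEEPING.  **ROW W3-F2a AT MEMBER `j`, BASE-ROOT BORDER `vh₂S d Lc`** (an1's `vh₂S d L := vh₂SAt 0 L`) and the mixed table
`mixFFAt (toSite r) Lc` at a box root: §11 at `ρ := 0`. -/
theorem zfree_bracket_base (hLc : 1 ≤ Lc) {r : Fin (d + 1) → ℕ} (hr : r ∈ box (d + 1) Lc) (cE cVH cΛ cE₂ cB : ℝ) (j : ℕ) :
    (∀ (κ : Fin (d + 1)) (u : Site (d + 1)) (κ' : Fin (d + 1)) (u' t : Site (d + 1)),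
      (fun κ u κ' u' => (cE₂ * (Lc : ℝ) ^ (2 * (d + 1))) •
          mmRead Lc (K3OfK (unitK (sfStep Lc j) (smStep d Lc j) (KInvStep (d := d) Lc j)) Lc
            (unitS (sfStep Lc j) (smStep d Lc j) (Spure d Lc cE cVH cΛ j)) (unitM (sfStep Lc j) (smStep d Lc j) (M1 d Lc cΛ j))
            (W2SymOfK (unitK (sfStep Lc j) (smStep d Lc j) (KInvStep (d := d) Lc j)) Lc
              (unitS (sfStep Lc j) (smStep d Lc j) (Spure d Lc cE cVH cΛ j)) (unitM (sfStep Lc j) (smStep d Lc j) (M1 d Lc cΛ j)) 0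
              (unitM₂ (sfStep Lc j) (smStep d Lc j) (M2Of d Lc (mixFFAt (toSite r) Lc) j))) κ u κ' u')
        + cB • mfNeg ((vh₂S d Lc) κ u κ' u')) κ (u + (Lc : ℤ) • t) κ' (u' + (Lc : ℤ) • t)
      = shiftK (-((Lc : ℤ) • t)) ((fun κ u κ' u' => (cE₂ * (Lc : ℝ) ^ (2 * (d + 1))) •
          mmRead Lc (K3OfK (unitK (sfStep Lc j) (smStep d Lc j) (KInvStep (d := d) Lc j)) Lc
            (unitS (sfStep Lc j) (smStep d Lc j) (Spure d Lc cE cVH cΛ j)) (unitM (sfStep Lc j) (smStep d Lc j) (M1 d Lc cΛ j))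
            (W2SymOfK (unitK (sfStep Lc j) (smStep d Lc j) (KInvStep (d := d) Lc j)) Lc
              (unitS (sfStep Lc j) (smStep d Lc j) (Spure d Lc cE cVH cΛ j)) (unitM (sfStep Lc j) (smStep d Lc j) (M1 d Lc cΛ j)) 0
              (unitM₂ (sfStep Lc j) (smStep d Lc j) (M2Of d Lc (mixFFAt (toSite r) Lc) j))) κ u κ' u')
        + cB • mfNeg ((vh₂S d Lc) κ u κ' u')) κ u κ' u')) ∧
    (∀ (κ κ' κ₁ κ₂ : Fin (d + 1)),
      zmode Lc (fun κ u κ' u' => (cE₂ * (Lc : ℝ) ^ (2 * (d + 1))) •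
          mmRead Lc (K3OfK (unitK (sfStep Lc j) (smStep d Lc j) (KInvStep (d := d) Lc j)) Lc
            (unitS (sfStep Lc j) (smStep d Lc j) (Spure d Lc cE cVH cΛ j)) (unitM (sfStep Lc j) (smStep d Lc j) (M1 d Lc cΛ j))
            (W2SymOfK (unitK (sfStep Lc j) (smStep d Lc j) (KInvStep (d := d) Lc j)) Lc
              (unitS (sfStep Lc j) (smStep d Lc j) (Spure d Lc cE cVH cΛ j)) (unitM (sfStep Lc j) (smStep d Lc j) (M1 d Lc cΛ j)) 0
              (unitM₂ (sfStep Lc j) (smStep d Lc j) (M2Of d Lc (mixFFAt (toSite r) Lc) j))) κ u κ' u')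
        + cB • mfNeg ((vh₂S d Lc) κ u κ' u')) κ κ' (Sum.inl κ₁) (Sum.inl κ₂) = 0) :=
  zfree_bracket_an1 hLc hr 0 cE cVH cΛ cE₂ cB j

/-- NOT IN PRINT; OUR BOOKKEEPING.  **ROW W3-F2a, CELL CONJUNCT, IN THE SHAPE OF leaf-12's `T2ShapeThreeOfF2a.t2Shape_three_an1_of_F2a` ∕
`hW_three_an1_of_F2a` HYPOTHESIS `hZ`** (every `d`, `1 ≤ Lc`, box root `r`): `∀ m κ κ′ κ₁ κ₂, zmode Lc (b m) κ κ′ (inl κ₁) (inl κ₂) = 0` at the base-root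
border and `mixFFAt (toSite r) Lc`. -/
theorem hZ_cell_base (hLc : 1 ≤ Lc) {r : Fin (d + 1) → ℕ} (hr : r ∈ box (d + 1) Lc) (cE cVH cΛ cE₂ cB : ℝ) :
    ∀ m : ℕ, (∀ κ κ' κ₁ κ₂, zmode Lc (fun κ u κ' u' =>
        (cE₂ * (Lc : ℝ) ^ (2 * (d + 1))) •
            mmRead Lc (K3OfK (unitK (sfStep Lc m) (smStep d Lc m) (KInvStep (d := d) Lc m)) Lc
              (unitS (sfStep Lc m) (smStep d Lc m) (Spure d Lc cE cVH cΛ m)) (unitM (sfStep Lc m) (smStep d Lc m) (M1 d Lc cΛ m))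
              (W2SymOfK (unitK (sfStep Lc m) (smStep d Lc m) (KInvStep (d := d) Lc m)) Lc
                (unitS (sfStep Lc m) (smStep d Lc m) (Spure d Lc cE cVH cΛ m)) (unitM (sfStep Lc m) (smStep d Lc m) (M1 d Lc cΛ m)) 0
                (unitM₂ (sfStep Lc m) (smStep d Lc m) (M2Of d Lc (mixFFAt (toSite r) Lc) m))) κ u κ' u')
          + cB • mfNeg ((vh₂S d Lc) κ u κ' u')) κ κ' (Sum.inl κ₁) (Sum.inl κ₂) = 0) :=
  fun m => (zfree_bracket_base hLc hr cE cVH cΛ cE₂ cB m).2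

end Summit.QuantumFields.BalabanUV.Beta.GAN24.WSlotSourceZeroModeHolds

end
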